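import Summits.ResolutionOfSingularities.ResolutionOfSingularities.Theorems.EquisingularLiftEquisingularLiftNatChartLiftPatching
import Literature.AlgebraicGeometry.Resolution.RegularLocalRingsQuotient
import Mathlib.RingTheory.KrullDimension.NonZeroDivisors
import Mathlib.RingTheory.Ideal.KrullsHeightTheorem
import HarnessLib

/-!
# [OURS · L1 W4.5(b) · EL♮(3) · WIDTH TABLE D8 «NODAL HOSTED ROUND (HR-KEEP-N)», support debt S-D8-LIFT, part 4 (C5)] THE TWIST AT A POINT:
# two chart lifts whose difference section does not vanish at `z` are not both inside `𝔪²` there; and the node algebra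

res-L1-w45b-stub-4 g14 (desk R69 (iii) / DESK WORD g25-19; split of record STATUS 2026-08-29T04:20:51Z, brick (C5)).  OURS; NOT a statement of any
manuscript ([Hironaka2017] is a candidate under adjudication, nothing of it is asserted); AI-written, weaker than expert review.  No `sorry`; standard
axioms; DEF-FREE.  `--supports stmt-ResolutionOfSingularities-20148 --as helper`.

WHAT.
* ★ `not_le_sq_and_le_sq_of_isDiffSec` — in the (π)-engine currency (one principal small extension `t : X_n ↪ X_{n+1}`, chart `U`, trace map
  `π_U`, special fibre `ι : Y₀ ↪ X₀`): two chart lifts `J, J'` on `U` with difference section `μ` (F5 `IsDiffSec`), a point `z ∈ Y₀` over `U`, a section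
  `m ∈ 𝓘(trace U)` with `μ(η m)` a UNIT at `z`, and `ε ∉ 𝔪²` at the point of `X_{n+1}` under `z` ⟹ NOT BOTH `J·𝒪 ≤ 𝔪²` and `J'·𝒪 ≤ 𝔪²` at that point.
  (Representative form of `IsDiffSec`: `m = π j`, `j − ε y ∈ J'`, `μ(η m) = ι♯(π y)`; the germ of `y` is a unit because `ι♯ π` is a chain of local
  stalk maps; if both germs `j`, `j − εy` lay in `𝔪²` then `ε·y ∈ 𝔪²`, i.e. `ε ∈ 𝔪²`.)  USE (C6): among the twists `G_{c·ψ}` (✓ `exists_idealSheafData_twist`,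
  p696354) of a first-order lift, `c ∈ k`, AT MOST ONE is inside `𝔪²` at a given non-regular point of `Z̃` — their pairwise difference sections are
  `(c' − c)·ψ|`, units at the point by (N4).
* `withBot_enat_add_one_le_self` — `a + 1 ≤ a` is impossible for `⊥ < a < ⊤` in `WithBot ℕ∞` (arithmetic).
* ★ `isRegularLocalRing_quotient_of_mem_of_not_mem_sq` — the node algebra: `B` regular local, `F ∈ 𝔞` with `F ∈ 𝔪 ∖ 𝔪²`, `𝔞 ≠ ⊤`, and
  `dim B⧸𝔞 + 1 = dim B` ⟹ `𝔞 = (F)` and `B⧸𝔞` is a regular local ring (`B⧸(F)` is a regular domain of dimension `dim B − 1` by Literature ✓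
  `IsRegularLocalRing.quotient_span_singleton`; a further non-zero element of `𝔞` would drop the dimension, Mathlib `ringKrullDim_quotient_succ_le_of_nonZeroDivisor`).
[cite: Hartshorne2010, Thm. 6.2 (a) (proof pp. 47–48)] [cite: Matsumura1987, Thm. 14.2] [folklore]
-/

set_option linter.dupNamespace false -- mandated namespace `Summit.<Summit>.<Problem>` of this single-conjunct summit
-- `TopCat.Presheaf`/`Scheme.Modules` are not reducible (as in Mathlib's `AlgebraicGeometry/Modules` and the tree's `Modules/*`).
set_option backward.isDefEq.respectTransparency false

noncomputable section

open CategoryTheory CategoryTheory.Limits AlgebraicGeometry Opposite TopologicalSpace IsLocalRing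
open Literature.AlgebraicGeometry.Resolution
open Literature.AlgebraicGeometry.Morphisms Literature.AlgebraicGeometry.Modules Literature.AlgebraicGeometry.Deformation
open Literature.AlgebraicGeometry.HodgeTheory

namespace Summit.ResolutionOfSingularities.ResolutionOfSingularities.Cruxes.EquisingularLiftNat.Sections

universe u

/-! ## Two chart lifts with a non-vanishing difference are not both inside `𝔪²` -/

section Point

variable {A : Type} [CommRing A] {I : Ideal A} {X : Scheme.{0}} {f : X ⟶ Spec (.of A)} {n : ℕ} {k₀ : Type} [CommRing k₀] {q : A →+* k₀}
  {hq : Function.Surjective q} {hI : I ≤ RingHom.ker q} {X₀ : Scheme.{0}} {j₀ : X₀ ⟶ X} {t₀ : X₀ ⟶ Spec (.of k₀)}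
  {hsq : IsPullback j₀ t₀ f (Spec.map (CommRingCat.ofHom q))} {Yn Y₀ : Scheme.{0}} {jn : Yn ⟶ infinitesimalNeighbourhood I f n}
  [IsClosedImmersion jn] {ι : Y₀ ⟶ X₀} [IsClosedImmersion ι] {s₀ : Y₀ ⟶ Yn}
  (hs₀ : IsPullback s₀ ι (jn ≫ infinitesimalNeighbourhood.ι I f n) j₀)
  {ε : A ⧸ I ^ (n + 1 + 1)} (hkert : RingHom.ker (infinitesimalNeighbourhood.transitionRingHom I n) = Ideal.span {ε})

include hq hs₀ hkert in
/-- ★ **TWO CHART LIFTS WITH A DIFFERENCE SECTION NOT VANISHING AT `z` ARE NOT BOTH INSIDE `𝔪²` AT THE POINT UNDER `z`.**  In the (π)-engine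
currency: `J, J'` chart lifts on the affine chart `U ⊆ X_{n+1}`, `μ` their difference section on the trace, `z ∈ Y₀` over `U`, `m ∈ 𝓘(trace U)` with
`μ(η m)` a unit at `z`, and the germ of `ε` at `x = t(e(ι z))` not in `𝔪_x²`; then `J·𝒪_{x} ≤ 𝔪_x²` and `J'·𝒪_{x} ≤ 𝔪_x²` do not both hold.
See the module docstring. [cite: Hartshorne2010, Thm. 6.2 (a) (proof)] [OURS · L1 W4.5b · WIDTH TABLE D8, support debt S-D8-LIFT, brick (C5)] -/
theorem not_le_sq_and_le_sq_of_isDiffSec {U : (infinitesimalNeighbourhood I f (n + 1)).affineOpens}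
    {J J' : Ideal Γ(infinitesimalNeighbourhood I f (n + 1), U)} (hJ : IsChartLift I f n jn U J) (hJ' : IsChartLift I f n jn U J')
    {μ : (conormalSheaf ι).over (ι ⁻¹ᵁ (traceChart I f n q hq hI hsq U : X₀.Opens)) ⟶ (unitModule Y₀).over (ι ⁻¹ᵁ (traceChart I f n q hq hI hsq U : X₀.Opens))}
    (hμ : letI := chartAlg I f (n + 1) U; IsDiffSec ι ε (traceHom I f n q hI hsq U) J J' μ)
    {z : Y₀} (hz : z ∈ ι ⁻¹ᵁ (traceChart I f n q hq hI hsq U : X₀.Opens))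
    (m : Γ(idealModule ι, (traceChart I f n q hq hI hsq U : X₀.Opens)))
    (hm : IsUnit (Y₀.presheaf.germ (ι ⁻¹ᵁ (traceChart I f n q hq hI hsq U : X₀.Opens)) z hz
      (appLE μ (𝟙 _) (unitSectionLE ι (idealModule ι) (le_refl _) m))))
    (hε : (infinitesimalNeighbourhood I f (n + 1)).presheaf.germ (U : (infinitesimalNeighbourhood I f (n + 1)).Opens)
        ((infinitesimalNeighbourhood.transition I f n).base ((fibreEmb I f q hI hsq n).base (ι.base z))) hz
        (letI := chartAlg I f (n + 1) U; algebraMap (A ⧸ I ^ (n + 1 + 1)) Γ(infinitesimalNeighbourhood I f (n + 1), U) ε) ∉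
      maximalIdeal ((infinitesimalNeighbourhood I f (n + 1)).presheaf.stalk
        ((infinitesimalNeighbourhood.transition I f n).base ((fibreEmb I f q hI hsq n).base (ι.base z)))) ^ 2) :
    ¬ (J.map ((infinitesimalNeighbourhood I f (n + 1)).presheaf.germ (U : (infinitesimalNeighbourhood I f (n + 1)).Opens)
            ((infinitesimalNeighbourhood.transition I f n).base ((fibreEmb I f q hI hsq n).base (ι.base z))) hz).hom ≤
          maximalIdeal _ ^ 2 ∧
        J'.map ((infinitesimalNeighbourhood I f (n + 1)).presheaf.germ (U : (infinitesimalNeighbourhood I f (n + 1)).Opens)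
            ((infinitesimalNeighbourhood.transition I f n).base ((fibreEmb I f q hI hsq n).base (ι.base z))) hz).hom ≤
          maximalIdeal _ ^ 2) := by
  classical
  rintro ⟨h1, h2⟩
  haveI hfE := isClosedImmersion_fibreEmb I f q hI hsq hq n
  haveI ht := isClosedImmersion_transition I f n
  letI := chartAlg I f (n + 1) U
  have hπ : Function.Surjective (traceHom I f n q hI hsq U) := traceHom_surjective I f n q hq hI hsq U
  have hJπ : J.map (traceHom I f n q hI hsq U) = ι.ker.ideal (traceChart I f n q hq hI hsq U) := hJ.map_traceHom I f n q hq hI hsq hs₀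
  -- `m = π j`, `j ∈ J`
  obtain ⟨j, hj, hjm⟩ := exists_mem_apply_eq_toRing ι (traceHom I f n q hI hsq U) hπ hJπ m
  -- `j − ε y ∈ J'`
  have hle := hJ.le_sup_span hkert hJ'
  obtain ⟨j', hj', w, hw, hjw⟩ := Submodule.mem_sup.mp (hle hj)
  obtain ⟨y, rfl⟩ := Ideal.mem_span_singleton'.mp hw
  have hjy : j - algebraMap (A ⧸ I ^ (n + 1 + 1)) Γ(infinitesimalNeighbourhood I f (n + 1), U) ε * y ∈ J' := by
    have e : j - algebraMap (A ⧸ I ^ (n + 1 + 1)) Γ(infinitesimalNeighbourhood I f (n + 1), U) ε * y = j' := by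
      rw [← hjw, mul_comm y, add_sub_cancel_right]
    rw [e]; exact hj'
  -- the value of the difference section: `μ(η m) = ι♯(π y)`
  have hval : appLE μ (𝟙 (ι ⁻¹ᵁ (traceChart I f n q hq hI hsq U : X₀.Opens))) (unitSectionLE ι (idealModule ι) (le_refl _) m) =
      ι.app (traceChart I f n q hq hI hsq U : X₀.Opens) (traceHom I f n q hI hsq U y) := hμ m j y hj hjm.symm hjy
  rw [hval] at hm
  -- the germ of `y` at `x` is a unit: `z` lies in the basic open of `ι♯(π y)`, the preimage of the basic open of `y`
  have hy : IsUnit ((infinitesimalNeighbourhood I f (n + 1)).presheaf.germ (U : (infinitesimalNeighbourhood I f (n + 1)).Opens)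
      ((infinitesimalNeighbourhood.transition I f n).base ((fibreEmb I f q hI hsq n).base (ι.base z))) hz y) := by
    rw [← Scheme.mem_basicOpen] at hm ⊢
    rw [← Scheme.preimage_basicOpen, traceHom_apply, ← Scheme.preimage_basicOpen, ← Scheme.preimage_basicOpen] at hm
    exact hm
  -- both germs in `𝔪²` force `ε ∈ 𝔪²`
  have hgj := h1 (Ideal.mem_map_of_mem _ hj)
  have hgj' := h2 (Ideal.mem_map_of_mem _ hjy)
  have hεy := Ideal.sub_mem _ hgj hgj'
  rw [map_sub, sub_sub_cancel, map_mul] at hεy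
  obtain ⟨u, hu⟩ := hy
  apply hε
  have h3 := Ideal.mul_mem_right
    (↑u⁻¹ : (infinitesimalNeighbourhood I f (n + 1)).presheaf.stalk
      ((infinitesimalNeighbourhood.transition I f n).base ((fibreEmb I f q hI hsq n).base (ι.base z)))) _ hεy
  rwa [← hu, mul_assoc, Units.mul_inv, mul_one] at h3

end Point

/-! ## Arithmetic -/

/-- `a + 1 ≤ a` is impossible in `WithBot ℕ∞` unless `a = ⊥` or `a = ⊤`. [elementary] -/
theorem withBot_enat_add_one_le_self {a : WithBot ℕ∞} (hb : a ≠ ⊥) (ht : a ≠ ⊤) (h : a + 1 ≤ a) : False := by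
  induction a using WithBot.recBotCoe with
  | bot => exact hb rfl
  | coe b =>
    induction b using ENat.recTopCoe with
    | top => exact ht rfl
    | coe m =>
      have h' : ((m + 1 : ℕ) : WithBot ℕ∞) ≤ ((m : ℕ) : WithBot ℕ∞) := by
        have e : ((m + 1 : ℕ) : WithBot ℕ∞) = ((m : ℕ∞) : WithBot ℕ∞) + 1 := by push_cast; rfl
        rw [e]; exact h
      have := (WithBot.coe_le_coe.mp (by exact_mod_cast h' : ((m + 1 : ℕ∞) : WithBot ℕ∞) ≤ ((m : ℕ∞) : WithBot ℕ∞)))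
      have hmm : (m + 1 : ℕ) ≤ m := by exact_mod_cast this
      omega

/-! ## The node algebra -/

/-- ★ **THE NODE ALGEBRA.**  `B` a regular local ring, `𝔞 ≠ ⊤` an ideal containing an element `F ∈ 𝔪 ∖ 𝔪²`, and `dim B⧸𝔞 + 1 = dim B`.  Then
`𝔞 = (F)` and `B ⧸ 𝔞` is a regular local ring.  (`B⧸(F)` is a regular local ring — hence a domain — with `dim B⧸(F) + 1 = dim B`, Literature ✓
`IsRegularLocalRing.quotient_span_singleton`; if `𝔞` contained an element outside `(F)`, its image would be a non-zero-divisor of `B⧸(F)` and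
`dim B⧸𝔞 + 1 ≤ dim B⧸(F)`, Mathlib `ringKrullDim_quotient_succ_le_of_nonZeroDivisor`, contradicting the dimension count.)  In the application `B = 𝒪_{V(𝓔),x}`
at a non-regular point of the special fibre, `𝔞` = the stalk of the lifted centre, `F` its local equation with unit `ϖ`-coefficient.
[cite: Matsumura1987, Thm. 14.2] [folklore] [OURS · L1 W4.5b · WIDTH TABLE D8, support debt S-D8-LIFT, brick (C5)] -/
theorem isRegularLocalRing_quotient_of_mem_of_not_mem_sq {B : Type u} [CommRing B] [IsRegularLocalRing B] {𝔞 : Ideal B} {F : B}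
    (hF𝔞 : F ∈ 𝔞) (hFm : F ∈ maximalIdeal B) (hF2 : F ∉ maximalIdeal B ^ 2) (h𝔞 : 𝔞 ≠ ⊤)
    (hdim : ringKrullDim (B ⧸ 𝔞) + 1 = ringKrullDim B) :
    𝔞 = Ideal.span {F} ∧ IsRegularLocalRing (B ⧸ 𝔞) := by
  obtain ⟨hRreg, hRdim⟩ := Literature.AlgebraicGeometry.Resolution.IsRegularLocalRing.quotient_span_singleton hFm hF2
  haveI := hRreg
  haveI : IsDomain (B ⧸ Ideal.span {F}) := isDomain_of_isRegularLocalRing _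
  have hle : Ideal.span {F} ≤ 𝔞 := (Ideal.span_singleton_le_iff_mem _).mpr hF𝔞
  -- `𝔞 = (F)`: otherwise the dimension drops
  have heq : 𝔞 = Ideal.span {F} := by
    by_contra hne
    have hlt : Ideal.span {F} < 𝔞 := lt_of_le_of_ne hle (Ne.symm hne)
    obtain ⟨a, ha𝔞, haF⟩ := SetLike.exists_of_lt hlt
    -- the image `r` of `a` in `R = B⧸(F)` is non-zero, hence a non-zero-divisor
    set R := B ⧸ Ideal.span {F} with hR
    have hr0 : Ideal.Quotient.mk (Ideal.span {F}) a ≠ 0 := by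
      rw [Ne, Ideal.Quotient.eq_zero_iff_mem]; exact haF
    have hr : Ideal.Quotient.mk (Ideal.span {F}) a ∈ nonZeroDivisors R := mem_nonZeroDivisors_of_ne_zero hr0
    -- `B⧸𝔞 ≃ R⧸𝔞'`, `𝔞' = 𝔞·R ∋ r`
    let e : (R ⧸ 𝔞.map (Ideal.Quotient.mk (Ideal.span {F}))) ≃+* B ⧸ 𝔞 := DoubleQuot.quotQuotEquivQuotOfLE hle
    have hdim1 : ringKrullDim (B ⧸ 𝔞) = ringKrullDim (R ⧸ 𝔞.map (Ideal.Quotient.mk (Ideal.span {F}))) :=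
      (ringKrullDim_eq_of_ringEquiv e).symm
    have hspan : Ideal.span {Ideal.Quotient.mk (Ideal.span {F}) a} ≤ 𝔞.map (Ideal.Quotient.mk (Ideal.span {F})) :=
      (Ideal.span_singleton_le_iff_mem _).mpr (Ideal.mem_map_of_mem _ ha𝔞)
    have hdim2 : ringKrullDim (R ⧸ 𝔞.map (Ideal.Quotient.mk (Ideal.span {F}))) ≤
        ringKrullDim (R ⧸ Ideal.span {Ideal.Quotient.mk (Ideal.span {F}) a}) :=
      ringKrullDim_le_of_surjective (Ideal.Quotient.factor hspan) (Ideal.Quotient.factor_surjective hspan)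
    have hdim3 : ringKrullDim (R ⧸ Ideal.span {Ideal.Quotient.mk (Ideal.span {F}) a}) + 1 ≤ ringKrullDim R :=
      ringKrullDim_quotient_succ_le_of_nonZeroDivisor hr
    -- `dim B⧸𝔞 + 1 ≤ dim R` and `dim R + 1 = dim B = dim B⧸𝔞 + 1`
    have h4 : ringKrullDim (B ⧸ 𝔞) + 1 ≤ ringKrullDim R := by
      rw [hdim1]
      exact le_trans (by gcongr) hdim3
    have h5 : ringKrullDim R = ringKrullDim (B ⧸ 𝔞) := by
      -- cancel `+ 1` using finiteness of `dim R`
      have hfin : ringKrullDim R ≠ ⊤ := ringKrullDim_ne_top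
      haveI : Nontrivial R := inferInstance
      have hbot : ringKrullDim R ≠ ⊥ := ringKrullDim_ne_bot
      have e1 : ringKrullDim R + 1 = ringKrullDim (B ⧸ 𝔞) + 1 := by rw [hRdim, hdim]
      revert e1 hfin hbot
      generalize ringKrullDim R = a
      generalize ringKrullDim (B ⧸ 𝔞) = b
      intro hfin hbot e1
      induction a using WithBot.recBotCoe with
      | bot => exact (hbot rfl).elim
      | coe a' =>
        induction b using WithBot.recBotCoe with
        | bot =>
          exfalso
          rw [WithBot.bot_add] at e1
          exact WithBot.coe_ne_bot (by exact_mod_cast e1)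
        | coe b' =>
          induction a' using ENat.recTopCoe with
          | top => exact (hfin rfl).elim
          | coe a'' =>
            induction b' using ENat.recTopCoe with
            | top =>
              exfalso
              have e2 : ((a'' : ℕ∞) : WithBot ℕ∞) + 1 = ((⊤ : ℕ∞) : WithBot ℕ∞) + 1 := e1
              rw [← WithBot.coe_one, ← WithBot.coe_add, ← WithBot.coe_add, WithBot.coe_inj, top_add] at e2
              exact ENat.coe_ne_top _ (by exact_mod_cast e2)
            | coe b'' =>
              have e2 : ((a'' + 1 : ℕ) : WithBot ℕ∞) = ((b'' + 1 : ℕ) : WithBot ℕ∞) := by push_cast at e1 ⊢; exact e1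
              have := Nat.cast_injective (R := WithBot ℕ∞) e2
              have hab : a'' = b'' := by omega
              subst hab; rfl
    rw [h5] at h4
    haveI : Nontrivial (B ⧸ 𝔞) := Ideal.Quotient.nontrivial_iff.mpr h𝔞
    haveI : IsLocalRing (B ⧸ 𝔞) := IsLocalRing.of_surjective' _ Ideal.Quotient.mk_surjective
    haveI : IsNoetherianRing (B ⧸ 𝔞) := inferInstance
    exact withBot_enat_add_one_le_self ringKrullDim_ne_bot ringKrullDim_ne_top h4
  refine ⟨heq, ?_⟩
  subst heq
  exact hRreg

end Summit.ResolutionOfSingularities.ResolutionOfSingularities.Cruxes.EquisingularLiftNat.Sections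

end
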